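import Summits.ABC.ABC.Theorems.IneffectiveSubspaceTowerExponentWindowFlatBoundOfDepth
import Summits.ABC.ABC.Theorems.IneffectiveSubspaceTowerExponentWindowFlatBoundOfDepth3
import Summits.ABC.ABC.Theorems.IneffectiveSubspaceTowerExponentWindowPolyAbcOfFlatBound
import Literature.Barriers.ABC.BakerMethodBounds

/-!
# `TowerExponentWindow` (stmt-ABC-1647) — line `binomial-xi-d-zero-threefold`: composition and status of the lever

The line (crux idea `Cruxes/TowerExponentWindow/Ideas/binomial-xi-d-zero-threefold.md`, skeleton v2
`Cruxes/TowerExponentWindow/Lines/binomial-xi-d-zero-threefold.lean`) reduces the crux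
`Summit.ABC.ABC.Theses.IneffectiveSubspace.TowerExponentWindow` (Vojta's tower inequality at SOME level `n` with SOME
exponent `A < n/3`) to ONE transcendence statement, the **binomial depth window** ("lever"): at one level `n`, every
divisor `d` of `a₁a₂ⁿ − c₁c₂ⁿ` (positive data, `gcd(a₁a₂, c₁c₂) = 1`) satisfies
`log d ≤ A₁·log max(a₁,c₁) + A₂·log max(a₂,c₂) + C₂·log rad d + C'` with `A₂ + C₂ < n` — Baker–Wüstholz's
conjectured Ξ-shape ((i) all places coupled with weight `log p`, (ii) additive in the heights) for ONE linear form
`log(a₁/c₁) + n·log(a₂/c₂)` in two rational logarithms, asking for ANY saving over the Liouville coefficient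
`(A₁,A₂,C₂) = (1,n,0)`. This file assembles the landed stubs:

* `towerExponentWindow_of_depthWindow3` — **lever (v2) ⟹ crux**: dictionary `stub_flatBoundOfDepth3` (lever ⟹
  Vojta's `D = 0` flat bound `wZⁿ ≤ K(uvw)^κ` on `uXⁿ + vYⁿ = wZⁿ`), lift `stub_polyAbcOfFlatBound` (flat bound ⟹
  polynomial abc), and `towerExponentWindow_of_polyAbc` (polynomial abc ⟹ the crux, `rad(abc) ≤ ∏ xᵢyᵢzᵢ`);
  `towerExponentWindow_of_binomialDepthWindow` — the same from the planner's one-constant lever (v1, window `3C < n`)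
  through `stub_flatBoundOfDepth`.
* `depthWindow3_of_polyAbc` — **polynomial abc ⟹ lever (v2)** at every level `n > 3·max κ 1`; hence
  `towerExponentWindow_iff_depthWindow3` — **crux ⟺ lever (v2)** given route item `WindowGivesPolynomialAbc`
  (stmt-ABC-1653: crux ⟹ polynomial abc), and `abc_imp_depthWindow3` — `ABC ⟹ lever`.

STATUS. The crux is thereby closed MODULO the lever, and the lever is crux-EQUIVALENT: the line is a certified
conditional reformulation of `TowerExponentWindow` (⟺ polynomial abc, open; best unconditional bound subexponential,
`Literature.NumberTheory.DiophantineGeometry.stewart_yu`, barrier `Literature.Barriers.ABC.BakerMethodBounds`) in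
two-logarithm Ξ-coordinates; no proved two-logarithm estimate (Laurent–Mignotte–Nesterenko 1995, Bugeaud–Laurent 1996,
Bombieri–Cohen 1997/2001) has the required shape (they carry `h₁h₂`, a factor `p` per prime, one place at a time).
Lead prover prover-line-stmt-ABC-1647-0, 2026-08-16. No new definitions; statements are spelled out verbatim.
-/

-- `Summit.<Summit>.<Problem>` is the mandated summit-side namespace (CONVENTIONS §2); for the
-- single-conjunct summit `ABC` the two coincide, so the duplicate `ABC.ABC` is deliberate.
set_option linter.dupNamespace false

namespace Summit.ABC.ABC.Theorems

open scoped BigOperators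
open Literature.NumberTheory.DiophantineGeometry

/-! ## Polynomial abc ⟹ the crux -/

/-- **Polynomial abc gives the tower inequality at EVERY level, with exponent `max κ 1`.** For a tower point put
`a = ∏ xᵢ^(i+1)` etc.; `(a, b, c)` is an abc triple and `abc = ∏ (xᵢyᵢzᵢ)^(i+1) ∣ (∏ xᵢyᵢzᵢ)ⁿ`, so
`rad(abc) ≤ ∏ xᵢyᵢzᵢ` (`radical_le_of_dvd_pow`), whence `c < K·rad^κ ≤ K·Π^(max κ 1 + ε)`.
(Planner's `tower_of_polyAbc` from the skeleton, verbatim.) [cite: Vojta2000ABC, §3.1] -/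
theorem TowerExponentWindow.tower_of_polyAbc {κ K : ℝ} (hK : 0 < K)
    (hP : ∀ a b c : ℕ, IsABCTriple a b c → (c : ℝ) < K * ((rad a b c : ℕ) : ℝ) ^ κ)
    (n : ℕ) {ε : ℝ} (hε : 0 < ε) (x y z : Fin n → ℕ) (hpos : ∀ i, 0 < x i ∧ 0 < y i ∧ 0 < z i)
    (hsum : (∏ i, x i ^ (i.val + 1)) + (∏ i, y i ^ (i.val + 1)) = ∏ i, z i ^ (i.val + 1))
    (hcop : Nat.Coprime (∏ i, x i ^ (i.val + 1)) (∏ i, y i ^ (i.val + 1))) :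
    ((∏ i, z i ^ (i.val + 1) : ℕ) : ℝ) < K * ((∏ i, x i * y i * z i : ℕ) : ℝ) ^ (max κ 1 + ε) := by
  set a : ℕ := ∏ i, x i ^ (i.val + 1) with ha
  set b : ℕ := ∏ i, y i ^ (i.val + 1) with hb
  set c : ℕ := ∏ i, z i ^ (i.val + 1) with hc
  set P : ℕ := ∏ i, x i * y i * z i with hPdef
  have ha0 : 0 < a := Finset.prod_pos fun i _ => pow_pos (hpos i).1 _
  have hb0 : 0 < b := Finset.prod_pos fun i _ => pow_pos (hpos i).2.1 _
  have hP0 : 0 < P := Finset.prod_pos fun i _ => mul_pos (mul_pos (hpos i).1 (hpos i).2.1) (hpos i).2.2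
  have habc : IsABCTriple a b c := ⟨ha0, hb0, hsum, hcop⟩
  have hdvd : a * b * c ∣ P ^ n := by
    rw [ha, hb, hc, hPdef, ← Finset.prod_mul_distrib, ← Finset.prod_mul_distrib, ← Finset.prod_pow]
    refine Finset.prod_dvd_prod_of_dvd _ _ fun i _ => ?_
    rw [← mul_pow, ← mul_pow]
    exact pow_dvd_pow _ (Nat.succ_le_of_lt i.isLt)
  have hrad : rad a b c ≤ P := by
    rw [rad_def]
    exact radical_le_of_dvd_pow hP0.ne' hdvd
  have hR1 : (1 : ℝ) ≤ ((rad a b c : ℕ) : ℝ) := Literature.Barriers.ABC.one_le_rad_real a b c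
  have hRP : ((rad a b c : ℕ) : ℝ) ≤ ((P : ℕ) : ℝ) := by exact_mod_cast hrad
  have hκ : κ ≤ max κ 1 + ε := (le_max_left _ _).trans (le_add_of_nonneg_right hε.le)
  have h0e : 0 ≤ max κ 1 + ε := by
    have : (1 : ℝ) ≤ max κ 1 := le_max_right _ _
    linarith
  calc ((c : ℕ) : ℝ) < K * ((rad a b c : ℕ) : ℝ) ^ κ := hP a b c habc
    _ ≤ K * ((rad a b c : ℕ) : ℝ) ^ (max κ 1 + ε) :=
        mul_le_mul_of_nonneg_left (Real.rpow_le_rpow_of_exponent_le hR1 hκ) hK.le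
    _ ≤ K * ((P : ℕ) : ℝ) ^ (max κ 1 + ε) :=
        mul_le_mul_of_nonneg_left (Real.rpow_le_rpow (by positivity) hRP h0e) hK.le

/-- **Polynomial abc ⟹ `TowerExponentWindow`** (converse of route item `WindowGivesPolynomialAbc`): with
`c < K·rad(abc)^κ`, take `A = max κ 1` and the level `n = ⌈3A⌉₊ + 1 > 3A`. [cite: Vojta2000ABC, §3.1] -/
theorem towerExponentWindow_of_polyAbc :
    (∃ κ C : ℝ, 0 < C ∧ ∀ a b c : ℕ, IsABCTriple a b c → (c : ℝ) < C * ((rad a b c : ℕ) : ℝ) ^ κ) →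
      Summit.ABC.ABC.Theses.IneffectiveSubspace.TowerExponentWindow := by
  intro h
  obtain ⟨κ, K, hK, hP⟩ := h
  have hA1 : (1 : ℝ) ≤ max κ 1 := le_max_right _ _
  refine ⟨⌈3 * max κ 1⌉₊ + 1, by omega, max κ 1, by linarith, ?_, fun ε hε => ⟨K, hK, ?_⟩⟩
  · have h1 : 3 * max κ 1 ≤ (⌈3 * max κ 1⌉₊ : ℝ) := Nat.le_ceil _
    push_cast
    linarith
  · intro x y z hpos hsum hcop
    exact TowerExponentWindow.tower_of_polyAbc hK hP _ hε x y z hpos hsum hcop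

/-! ## Lever ⟹ crux (the line, assembled from the landed stubs) -/

/-- **Lever (v2) ⟹ `TowerExponentWindow`.** The level `n` of the lever is `≥ 1` (as `0 ≤ A₂ + C₂ < n`); the
refined dictionary `stub_flatBoundOfDepth3` gives the flat bound at level `n`, the lift `stub_polyAbcOfFlatBound`
gives polynomial abc, and `towerExponentWindow_of_polyAbc` the crux. CONDITIONAL on the lever (open). [folklore] -/
theorem towerExponentWindow_of_depthWindow3 :
    (∃ n : ℕ, ∃ A₁ A₂ C₂ C' : ℝ, 0 ≤ A₁ ∧ 0 ≤ A₂ ∧ 0 ≤ C₂ ∧ A₂ + C₂ < n ∧ ∀ a₁ a₂ c₁ c₂ : ℕ, 0 < a₁ → 0 < a₂ → 0 < c₁ → 0 < c₂ → Nat.Coprime (a₁ * a₂) (c₁ * c₂) → a₁ * a₂ ^ n ≠ c₁ * c₂ ^ n → ∀ d : ℕ, 0 < d → (d : ℤ) ∣ ((a₁ * a₂ ^ n : ℕ) : ℤ) - ((c₁ * c₂ ^ n : ℕ) : ℤ) → Real.log (d : ℝ) ≤ A₁ * Real.log ((max a₁ c₁ : ℕ) : ℝ) + A₂ * Real.log ((max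 a₂ c₂ : ℕ) : ℝ) + C₂ * Real.log ((UniqueFactorizationMonoid.radical d : ℕ) : ℝ) + C') →
      Summit.ABC.ABC.Theses.IneffectiveSubspace.TowerExponentWindow := by
  intro hA
  obtain ⟨n, A₁, A₂, C₂, C', hA₁, hA₂, hC₂, hwin, hD⟩ := hA
  have h0 : (0 : ℝ) < (n : ℝ) := by linarith
  have hn : 0 < n := by exact_mod_cast h0
  exact towerExponentWindow_of_polyAbc
    (stub_polyAbcOfFlatBound n (Nat.succ_le_of_lt hn) (stub_flatBoundOfDepth3 n A₁ A₂ C₂ C' hA₁ hA₂ hC₂ hwin hD))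

/-- **Lever (v1, planner's one-constant form, window `3C < n`) ⟹ `TowerExponentWindow`**, through the planner's
dictionary `stub_flatBoundOfDepth` and the lift. CONDITIONAL on the lever (open). [folklore] -/
theorem towerExponentWindow_of_binomialDepthWindow :
    (∃ n : ℕ, ∃ C C' : ℝ, 0 ≤ C ∧ 3 * C < n ∧ ∀ a₁ a₂ c₁ c₂ : ℕ, 0 < a₁ → 0 < a₂ → 0 < c₁ → 0 < c₂ → Nat.Coprime (a₁ * a₂) (c₁ * c₂) → a₁ * a₂ ^ n ≠ c₁ * c₂ ^ n → ∀ d : ℕ, 0 < d → (d : ℤ) ∣ ((a₁ * a₂ ^ n : ℕ) : ℤ) - ((c₁ * c₂ ^ n : ℕ) : ℤ) → Real.log (d : ℝ) ≤ C * (Real.log ((max a₁ c₁ : ℕ) : ℝ) + Real.log ((max a₂ c₂ : ℕ) : ℝ) + Real.log ((UniqueFactorizationMonoid.radical d : ℕ) : ℝ)) + C') →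
      Summit.ABC.ABC.Theses.IneffectiveSubspace.TowerExponentWindow := by
  intro hA
  obtain ⟨n, C, C', hC, h3, hD⟩ := hA
  have h0 : (0 : ℝ) < (n : ℝ) := by linarith
  have hn : 0 < n := by exact_mod_cast h0
  exact towerExponentWindow_of_polyAbc
    (stub_polyAbcOfFlatBound n (Nat.succ_le_of_lt hn) (stub_flatBoundOfDepth n C C' hC h3 hD))

/-! ## Polynomial abc ⟹ the lever: the lever is crux-equivalent -/

/-- Core of `depthIneq3_of_polyAbc`, orientation `c₁c₂ⁿ < a₁a₂ⁿ`: polynomial abc with exponent `k ≥ 1` and constant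
`K > 0` bounds every divisor `d` of `a₁a₂ⁿ − c₁c₂ⁿ` (coprime positive data) by
`log d ≤ (3 − 1/k)·log max(a₁,c₁) + (2 + n(1 − 1/k))·log max(a₂,c₂) + log rad d + (log K)/k`.
Proof: `(P − Q, Q, P)` is an abc triple (`P = a₁a₂ⁿ`, `Q = c₁c₂ⁿ`), `rad((P−Q)QP) ≤ rad d·(P−Q)/d·c₁c₂·a₁a₂`,
`(P − Q)/d ≤ P/d`, `log P ≤ h₁ + n h₂`. [folklore] -/
theorem DepthWindowOfPolyAbc.core {k K : ℝ} (hk : 1 ≤ k) (hK : 0 < K) {n : ℕ}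
    (hABC : ∀ a b c : ℕ, IsABCTriple a b c → (c : ℝ) < K * ((rad a b c : ℕ) : ℝ) ^ k)
    {a₁ a₂ c₁ c₂ d : ℕ} (ha₁ : 0 < a₁) (ha₂ : 0 < a₂) (hc₁ : 0 < c₁) (hc₂ : 0 < c₂)
    (hcop : Nat.Coprime (a₁ * a₂) (c₁ * c₂)) (hlt : c₁ * c₂ ^ n < a₁ * a₂ ^ n) (hd : 0 < d)
    (hdvd : (d : ℤ) ∣ ((a₁ * a₂ ^ n : ℕ) : ℤ) - ((c₁ * c₂ ^ n : ℕ) : ℤ)) :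
    Real.log (d : ℝ) ≤ (3 - 1 / k) * Real.log ((max a₁ c₁ : ℕ) : ℝ) +
      (2 + n * (1 - 1 / k)) * Real.log ((max a₂ c₂ : ℕ) : ℝ) +
      1 * Real.log ((UniqueFactorizationMonoid.radical d : ℕ) : ℝ) + Real.log K / k := by
  set P : ℕ := a₁ * a₂ ^ n with hPdef
  set Q : ℕ := c₁ * c₂ ^ n with hQdef
  have hP0 : 0 < P := by positivity
  have hQ0 : 0 < Q := by positivity
  -- `d ∣ P - Q` in `ℕ`
  obtain ⟨e, he⟩ : d ∣ P - Q := by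
    have h1 : ((P - Q : ℕ) : ℤ) = (P : ℤ) - (Q : ℤ) := Nat.cast_sub hlt.le
    have h2 : (d : ℤ) ∣ ((P - Q : ℕ) : ℤ) := by rw [h1]; exact hdvd
    exact Int.natCast_dvd_natCast.mp h2
  have hD0 : 0 < P - Q := Nat.sub_pos_of_lt hlt
  have he0 : 0 < e := by
    rcases Nat.eq_zero_or_pos e with h | h
    · rw [h, mul_zero] at he; omega
    · exact h
  -- `(P - Q, Q, P)` is an abc triple
  have hPd : P ∣ (a₁ * a₂) ^ n.succ := by
    rw [mul_pow]; exact mul_dvd_mul (dvd_pow_self a₁ (Nat.succ_ne_zero n)) (pow_dvd_pow a₂ n.le_succ)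
  have hQd : Q ∣ (c₁ * c₂) ^ n.succ := by
    rw [mul_pow]; exact mul_dvd_mul (dvd_pow_self c₁ (Nat.succ_ne_zero n)) (pow_dvd_pow c₂ n.le_succ)
  have hPQ : Nat.Coprime P Q :=
    Nat.Coprime.coprime_dvd_left hPd (Nat.Coprime.coprime_dvd_right hQd (Nat.Coprime.pow _ _ hcop))
  have hDQ : Nat.Coprime (P - Q) Q := (Nat.coprime_sub_self_left hlt.le).mpr hPQ
  have habc3 : IsABCTriple (P - Q) Q P := ⟨hD0, hQ0, Nat.sub_add_cancel hlt.le, hDQ⟩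
  have hmain := hABC _ _ _ habc3
  -- the radical bound in `ℕ`: `rad((P-Q)·Q·P) ≤ rad d · e · c₁c₂ · a₁a₂`
  have hDrad : UniqueFactorizationMonoid.radical (P - Q) ≤ UniqueFactorizationMonoid.radical d * e := by
    rw [he]
    calc UniqueFactorizationMonoid.radical (d * e)
        ≤ UniqueFactorizationMonoid.radical d * UniqueFactorizationMonoid.radical e :=
          Nat.le_of_dvd (mul_pos (Nat.radical_pos _) (Nat.radical_pos _))
            UniqueFactorizationMonoid.radical_mul_dvd
      _ ≤ UniqueFactorizationMonoid.radical d * e :=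
          Nat.mul_le_mul_left _ (Nat.radical_le_self_iff.mpr he0.ne')
  have hQrad : UniqueFactorizationMonoid.radical Q ≤ c₁ * c₂ :=
    radical_le_of_dvd_pow (n := n.succ) (by positivity) hQd
  have hPrad : UniqueFactorizationMonoid.radical P ≤ a₁ * a₂ :=
    radical_le_of_dvd_pow (n := n.succ) (by positivity) hPd
  have hradN : rad (P - Q) Q P ≤ UniqueFactorizationMonoid.radical d * e * (c₁ * c₂) * (a₁ * a₂) := by
    rw [rad_def]
    exact (radical_mul_three_le _ _ _).trans (Nat.mul_le_mul (Nat.mul_le_mul hDrad hQrad) hPrad)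
  -- real-side facts
  set R : ℝ := ((rad (P - Q) Q P : ℕ) : ℝ) with hRdef
  have hR1 : (1 : ℝ) ≤ R := Literature.Barriers.ABC.one_le_rad_real _ _ _
  have hR0 : 0 < R := by linarith
  have hPR : (0 : ℝ) < (P : ℝ) := by exact_mod_cast hP0
  have hdR : (0 : ℝ) < (d : ℝ) := by exact_mod_cast hd
  have heR : (0 : ℝ) < (e : ℝ) := by exact_mod_cast he0
  have ha₁R : (0 : ℝ) < (a₁ : ℝ) := by exact_mod_cast ha₁
  have ha₂R : (0 : ℝ) < (a₂ : ℝ) := by exact_mod_cast ha₂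
  have hc₁R : (0 : ℝ) < (c₁ : ℝ) := by exact_mod_cast hc₁
  have hc₂R : (0 : ℝ) < (c₂ : ℝ) := by exact_mod_cast hc₂
  have hrdR : (0 : ℝ) < ((UniqueFactorizationMonoid.radical d : ℕ) : ℝ) := by
    exact_mod_cast Nat.radical_pos d
  have hk0 : 0 < k := by linarith
  -- (1) abc, logarithmically
  have h1 : Real.log (P : ℝ) < Real.log K + k * Real.log R := by
    have h := Real.log_lt_log hPR hmain
    rwa [Real.log_mul hK.ne' (Real.rpow_pos_of_pos hR0 _).ne', Real.log_rpow hR0] at h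
  -- (2) the radical bound, logarithmically
  have h2 : Real.log R ≤ Real.log ((UniqueFactorizationMonoid.radical d : ℕ) : ℝ) + Real.log (e : ℝ) +
      (Real.log (c₁ : ℝ) + Real.log (c₂ : ℝ)) + (Real.log (a₁ : ℝ) + Real.log (a₂ : ℝ)) := by
    have hcast : R ≤ ((UniqueFactorizationMonoid.radical d : ℕ) : ℝ) * (e : ℝ) * ((c₁ : ℝ) * (c₂ : ℝ)) *
        ((a₁ : ℝ) * (a₂ : ℝ)) := by
      rw [hRdef]; exact_mod_cast hradN
    have h := Real.log_le_log hR0 hcast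
    rwa [Real.log_mul (mul_pos (mul_pos hrdR heR) (mul_pos hc₁R hc₂R)).ne' (mul_pos ha₁R ha₂R).ne',
      Real.log_mul (mul_pos hrdR heR).ne' (mul_pos hc₁R hc₂R).ne', Real.log_mul hrdR.ne' heR.ne',
      Real.log_mul hc₁R.ne' hc₂R.ne', Real.log_mul ha₁R.ne' ha₂R.ne'] at h
  -- (3) `d · e = P - Q ≤ P`
  have h3 : Real.log (d : ℝ) + Real.log (e : ℝ) ≤ Real.log (P : ℝ) := by
    have hDP : ((P - Q : ℕ) : ℝ) ≤ (P : ℝ) := by exact_mod_cast Nat.sub_le P Q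
    have hDe : ((P - Q : ℕ) : ℝ) = (d : ℝ) * (e : ℝ) := by rw [he]; push_cast; ring
    have h := Real.log_le_log (by rw [hDe]; positivity) hDP
    rwa [hDe, Real.log_mul hdR.ne' heR.ne'] at h
  -- (4) heights
  have h4 : Real.log (P : ℝ) = Real.log (a₁ : ℝ) + n * Real.log (a₂ : ℝ) := by
    have : (P : ℝ) = (a₁ : ℝ) * (a₂ : ℝ) ^ n := by rw [hPdef]; push_cast; ring
    rw [this, Real.log_mul ha₁R.ne' (pow_pos ha₂R n).ne', Real.log_pow]
  have h5a : Real.log (a₁ : ℝ) ≤ Real.log ((max a₁ c₁ : ℕ) : ℝ) :=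
    Real.log_le_log ha₁R (by exact_mod_cast le_max_left a₁ c₁)
  have h5c : Real.log (c₁ : ℝ) ≤ Real.log ((max a₁ c₁ : ℕ) : ℝ) :=
    Real.log_le_log hc₁R (by exact_mod_cast le_max_right a₁ c₁)
  have h6a : Real.log (a₂ : ℝ) ≤ Real.log ((max a₂ c₂ : ℕ) : ℝ) :=
    Real.log_le_log ha₂R (by exact_mod_cast le_max_left a₂ c₂)
  have h6c : Real.log (c₂ : ℝ) ≤ Real.log ((max a₂ c₂ : ℕ) : ℝ) :=
    Real.log_le_log hc₂R (by exact_mod_cast le_max_right a₂ c₂)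
  have h7 : 0 ≤ Real.log ((max a₁ c₁ : ℕ) : ℝ) :=
    Real.log_nonneg (by exact_mod_cast (le_max_left a₁ c₁).trans' ha₁)
  have h8 : 0 ≤ Real.log ((max a₂ c₂ : ℕ) : ℝ) :=
    Real.log_nonneg (by exact_mod_cast (le_max_left a₂ c₂).trans' ha₂)
  have h10 : 0 ≤ Real.log (a₁ : ℝ) := Real.log_nonneg (by exact_mod_cast ha₁)
  have h11 : 0 ≤ Real.log (a₂ : ℝ) := Real.log_nonneg (by exact_mod_cast ha₂)
  have hn0 : (0 : ℝ) ≤ n := Nat.cast_nonneg n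
  -- combine: k·log d < log K + k·log rad d + (k − 1)·log P + k(log a₁ + log c₁) + k(log a₂ + log c₂)
  have hcomb : k * Real.log (d : ℝ) ≤ Real.log K + k * Real.log ((UniqueFactorizationMonoid.radical d : ℕ) : ℝ) +
      (k - 1) * (Real.log ((max a₁ c₁ : ℕ) : ℝ) + n * Real.log ((max a₂ c₂ : ℕ) : ℝ)) +
      2 * k * Real.log ((max a₁ c₁ : ℕ) : ℝ) + 2 * k * Real.log ((max a₂ c₂ : ℕ) : ℝ) := by
    have hk1 : 0 ≤ k - 1 := by linarith
    have hPle : Real.log (P : ℝ) ≤ Real.log ((max a₁ c₁ : ℕ) : ℝ) + n * Real.log ((max a₂ c₂ : ℕ) : ℝ) := by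
      rw [h4]; nlinarith [mul_le_mul_of_nonneg_left h6a hn0]
    nlinarith [mul_le_mul_of_nonneg_left h2 hk0.le, mul_le_mul_of_nonneg_left hPle hk1,
      mul_le_mul_of_nonneg_left h5a hk0.le, mul_le_mul_of_nonneg_left h5c hk0.le,
      mul_le_mul_of_nonneg_left h6a hk0.le, mul_le_mul_of_nonneg_left h6c hk0.le]
  -- divide by k
  have hgoal : Real.log (d : ℝ) ≤ Real.log K / k + Real.log ((UniqueFactorizationMonoid.radical d : ℕ) : ℝ) +
      (3 - 1 / k) * Real.log ((max a₁ c₁ : ℕ) : ℝ) + (2 + n * (1 - 1 / k)) * Real.log ((max a₂ c₂ : ℕ) : ℝ) := by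
    rw [← sub_nonneg] at hcomb ⊢
    have e : Real.log K / k + Real.log ((UniqueFactorizationMonoid.radical d : ℕ) : ℝ) +
        (3 - 1 / k) * Real.log ((max a₁ c₁ : ℕ) : ℝ) + (2 + n * (1 - 1 / k)) * Real.log ((max a₂ c₂ : ℕ) : ℝ) -
        Real.log (d : ℝ) = (1 / k) * (Real.log K + k * Real.log ((UniqueFactorizationMonoid.radical d : ℕ) : ℝ) +
      (k - 1) * (Real.log ((max a₁ c₁ : ℕ) : ℝ) + n * Real.log ((max a₂ c₂ : ℕ) : ℝ)) +
      2 * k * Real.log ((max a₁ c₁ : ℕ) : ℝ) + 2 * k * Real.log ((max a₂ c₂ : ℕ) : ℝ) - k * Real.log (d : ℝ)) := by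
      field_simp; ring
    rw [e]; positivity
  linarith

/-- **Polynomial abc ⟹ the refined depth inequality at every level.**  If `c < K·rad(abc)^κ` on abc triples
(`K > 0`), then with `k = max κ 1`, for every `n` and all positive `a₁ a₂ c₁ c₂` with `gcd(a₁a₂, c₁c₂) = 1`,
`a₁a₂ⁿ ≠ c₁c₂ⁿ`, every positive divisor `d` of `a₁a₂ⁿ − c₁c₂ⁿ` (in `ℤ`) satisfies
`log d ≤ (3 − 1/k)·log max(a₁,c₁) + (2 + n(1 − 1/k))·log max(a₂,c₂) + 1·log rad d + (log K)/k`.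
The `h₂`-coefficient plus the `log rad d`-coefficient is `3 + n(1 − 1/k) < n` iff `n > 3k`. [folklore] -/
theorem depthIneq3_of_polyAbc {κ K : ℝ} (hK : 0 < K)
    (hABC : ∀ a b c : ℕ, IsABCTriple a b c → (c : ℝ) < K * ((rad a b c : ℕ) : ℝ) ^ κ) (n : ℕ) :
    ∀ a₁ a₂ c₁ c₂ : ℕ, 0 < a₁ → 0 < a₂ → 0 < c₁ → 0 < c₂ → Nat.Coprime (a₁ * a₂) (c₁ * c₂) →
      a₁ * a₂ ^ n ≠ c₁ * c₂ ^ n → ∀ d : ℕ, 0 < d → (d : ℤ) ∣ ((a₁ * a₂ ^ n : ℕ) : ℤ) - ((c₁ * c₂ ^ n : ℕ) : ℤ) →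
      Real.log (d : ℝ) ≤ (3 - 1 / max κ 1) * Real.log ((max a₁ c₁ : ℕ) : ℝ) +
        (2 + n * (1 - 1 / max κ 1)) * Real.log ((max a₂ c₂ : ℕ) : ℝ) +
        1 * Real.log ((UniqueFactorizationMonoid.radical d : ℕ) : ℝ) + Real.log K / max κ 1 := by
  -- upgrade the exponent to `k = max κ 1 ≥ 1` (`rad ≥ 1`)
  have hABC' : ∀ a b c : ℕ, IsABCTriple a b c → (c : ℝ) < K * ((rad a b c : ℕ) : ℝ) ^ (max κ 1) := by
    intro a b c h
    have hR1 : (1 : ℝ) ≤ ((rad a b c : ℕ) : ℝ) := Literature.Barriers.ABC.one_le_rad_real a b c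
    exact (hABC a b c h).trans_le
      (mul_le_mul_of_nonneg_left (Real.rpow_le_rpow_of_exponent_le hR1 (le_max_left _ _)) hK.le)
  intro a₁ a₂ c₁ c₂ ha₁ ha₂ hc₁ hc₂ hcop hne d hd hdvd
  rcases Nat.lt_or_gt_of_ne hne with hlt | hlt
  · -- `a₁a₂ⁿ < c₁c₂ⁿ`: exchange the roles of `a` and `c`
    have h := DepthWindowOfPolyAbc.core (le_max_right κ 1) hK hABC' hc₁ hc₂ ha₁ ha₂ hcop.symm hlt hd
      (dvd_sub_comm.mp hdvd)
    rwa [max_comm c₁ a₁, max_comm c₂ a₂] at h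
  · exact DepthWindowOfPolyAbc.core (le_max_right κ 1) hK hABC' ha₁ ha₂ hc₁ hc₂ hcop hlt hd hdvd

/-- **Polynomial abc ⟹ the refined lever** (the converse half of "lever ⟺ crux"): from `c < K·rad(abc)^κ` one gets
a level `n` (namely `⌊3·max κ 1⌋₊ + 1`) and nonnegative coefficients `A₁, A₂, C₂` with `A₂ + C₂ < n` such that the
refined depth inequality holds at level `n`. [folklore] -/
theorem depthWindow3_of_polyAbc
    (h : ∃ κ K : ℝ, 0 < K ∧ ∀ a b c : ℕ, IsABCTriple a b c → (c : ℝ) < K * ((rad a b c : ℕ) : ℝ) ^ κ) :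
    ∃ n : ℕ, ∃ A₁ A₂ C₂ C' : ℝ, 0 ≤ A₁ ∧ 0 ≤ A₂ ∧ 0 ≤ C₂ ∧ A₂ + C₂ < n ∧
      ∀ a₁ a₂ c₁ c₂ : ℕ, 0 < a₁ → 0 < a₂ → 0 < c₁ → 0 < c₂ → Nat.Coprime (a₁ * a₂) (c₁ * c₂) →
      a₁ * a₂ ^ n ≠ c₁ * c₂ ^ n → ∀ d : ℕ, 0 < d → (d : ℤ) ∣ ((a₁ * a₂ ^ n : ℕ) : ℤ) - ((c₁ * c₂ ^ n : ℕ) : ℤ) →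
      Real.log (d : ℝ) ≤ A₁ * Real.log ((max a₁ c₁ : ℕ) : ℝ) + A₂ * Real.log ((max a₂ c₂ : ℕ) : ℝ) +
        C₂ * Real.log ((UniqueFactorizationMonoid.radical d : ℕ) : ℝ) + C' := by
  obtain ⟨κ, K, hK, hABC⟩ := h
  set k : ℝ := max κ 1 with hk
  have hk1 : 1 ≤ k := le_max_right _ _
  have hk0 : 0 < k := by linarith
  refine ⟨⌊3 * k⌋₊ + 1, 3 - 1 / k, 2 + (⌊3 * k⌋₊ + 1 : ℕ) * (1 - 1 / k), 1, Real.log K / k, ?_, ?_, zero_le_one, ?_,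
    depthIneq3_of_polyAbc hK hABC _⟩
  · have : 1 / k ≤ 1 := by rw [div_le_one hk0]; exact hk1
    linarith
  · have h1 : 0 ≤ 1 - 1 / k := by rw [sub_nonneg, div_le_one hk0]; exact hk1
    positivity
  · -- window: `3 + n(1 − 1/k) < n` iff `3k < n`, and `n = ⌊3k⌋₊ + 1 > 3k`
    have hn : 3 * k < (⌊3 * k⌋₊ + 1 : ℕ) := by push_cast; exact Nat.lt_floor_add_one (3 * k)
    set N : ℝ := ((⌊3 * k⌋₊ + 1 : ℕ) : ℝ) with hN
    have e : 2 + N * (1 - 1 / k) + 1 = N - (N - 3 * k) / k := by field_simp; ring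
    rw [e]
    have : 0 < (N - 3 * k) / k := div_pos (by linarith) hk0
    linarith


/-- **`TowerExponentWindow` ⟺ lever (v2)**, given route item `WindowGivesPolynomialAbc` (stmt-ABC-1653, crux ⟹
polynomial abc; candidate proof attached to that item). The line is a REFORMULATION of the crux. [folklore] -/
theorem towerExponentWindow_iff_depthWindow3
    (h1653 : Summit.ABC.ABC.Theses.IneffectiveSubspace.WindowGivesPolynomialAbc) :
    Summit.ABC.ABC.Theses.IneffectiveSubspace.TowerExponentWindow ↔
      ∃ n : ℕ, ∃ A₁ A₂ C₂ C' : ℝ, 0 ≤ A₁ ∧ 0 ≤ A₂ ∧ 0 ≤ C₂ ∧ A₂ + C₂ < n ∧ ∀ a₁ a₂ c₁ c₂ : ℕ, 0 < a₁ → 0 < a₂ → 0 < c₁ → 0 < c₂ → Nat.Coprime (a₁ * a₂) (c₁ * c₂) → a₁ * a₂ ^ n ≠ c₁ * c₂ ^ n → ∀ d : ℕ, 0 < d → (d : ℤ) ∣ ((a₁ * a₂ ^ n : ℕ) : ℤ) - ((c₁ * c₂ ^ n : ℕ) : ℤ) → Real.log (d : ℝ) ≤ A₁ * Real.log ((max a₁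 c₁ : ℕ) : ℝ) + A₂ * Real.log ((max a₂ c₂ : ℕ) : ℝ) + C₂ * Real.log ((UniqueFactorizationMonoid.radical d : ℕ) : ℝ) + C' :=
  ⟨fun hT => depthWindow3_of_polyAbc (h1653 hT), towerExponentWindow_of_depthWindow3⟩

/-- **`ABC` ⟹ lever (v2)** (consistency of the open stub: it cannot be refuted short of refuting abc):
abc at `ε = 1` is polynomial abc with `κ = 2`. [folklore] -/
theorem abc_imp_depthWindow3 (habc : _root_.ABC) :
    ∃ n : ℕ, ∃ A₁ A₂ C₂ C' : ℝ, 0 ≤ A₁ ∧ 0 ≤ A₂ ∧ 0 ≤ C₂ ∧ A₂ + C₂ < n ∧ ∀ a₁ a₂ c₁ c₂ : ℕ, 0 < a₁ → 0 < a₂ → 0 < c₁ → 0 < c₂ → Nat.Coprime (a₁ * a₂) (c₁ * c₂) → a₁ * a₂ ^ n ≠ c₁ * c₂ ^ n → ∀ d : ℕ, 0 < d → (d : ℤ) ∣ ((a₁ * a₂ ^ n : ℕ) : ℤ) - ((c₁ * c₂ ^ n : ℕ) : ℤ) → Real.log (d : ℝ) ≤ A₁ * Real.log ((max a₁ c₁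 : ℕ) : ℝ) + A₂ * Real.log ((max a₂ c₂ : ℕ) : ℝ) + C₂ * Real.log ((UniqueFactorizationMonoid.radical d : ℕ) : ℝ) + C' := by
  obtain ⟨K, hK, h⟩ := habc 1 one_pos
  exact depthWindow3_of_polyAbc ⟨1 + 1, K, hK, h⟩

/-! ## The window is exactly "beat Liouville" -/

/-- **The trivial (Liouville) depth bound sits ON the boundary of the window**: at every level `n` the refined depth
inequality holds with `(A₁, A₂, C₂, C') = (1, n, 0, 0)`, because `d ≤ |a₁a₂ⁿ − c₁c₂ⁿ| ≤ max(a₁,c₁)·max(a₂,c₂)ⁿ`;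
the lever asks for `A₂ + C₂ < n`, i.e. for any improvement of the `h₂`-coefficient `n`. [folklore] -/
theorem depthIneq3_liouville (n : ℕ) :
    ∀ a₁ a₂ c₁ c₂ : ℕ, 0 < a₁ → 0 < a₂ → 0 < c₁ → 0 < c₂ → Nat.Coprime (a₁ * a₂) (c₁ * c₂) →
      a₁ * a₂ ^ n ≠ c₁ * c₂ ^ n → ∀ d : ℕ, 0 < d → (d : ℤ) ∣ ((a₁ * a₂ ^ n : ℕ) : ℤ) - ((c₁ * c₂ ^ n : ℕ) : ℤ) →
      Real.log (d : ℝ) ≤ 1 * Real.log ((max a₁ c₁ : ℕ) : ℝ) + n * Real.log ((max a₂ c₂ : ℕ) : ℝ) +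
        0 * Real.log ((UniqueFactorizationMonoid.radical d : ℕ) : ℝ) + 0 := by
  intro a₁ a₂ c₁ c₂ ha₁ ha₂ _hc₁ _hc₂ _hcop hne d hd hdvd
  set P : ℕ := a₁ * a₂ ^ n with hP
  set Q : ℕ := c₁ * c₂ ^ n with hQ
  -- `d ≤ |P - Q| ≤ max P Q ≤ max a₁ c₁ * (max a₂ c₂) ^ n`
  have hPle : P ≤ max a₁ c₁ * (max a₂ c₂) ^ n :=
    Nat.mul_le_mul (le_max_left _ _) (Nat.pow_le_pow_left (le_max_left _ _) n)
  have hQle : Q ≤ max a₁ c₁ * (max a₂ c₂) ^ n :=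
    Nat.mul_le_mul (le_max_right _ _) (Nat.pow_le_pow_left (le_max_right _ _) n)
  have hdle : d ≤ max a₁ c₁ * (max a₂ c₂) ^ n := by
    rcases le_or_gt Q P with hle | hlt
    · have h1 : ((P : ℕ) : ℤ) - (Q : ℤ) = ((P - Q : ℕ) : ℤ) := (Nat.cast_sub hle).symm
      rw [h1] at hdvd
      have h2 : d ∣ P - Q := Int.natCast_dvd_natCast.mp hdvd
      have h3 : 0 < P - Q := Nat.sub_pos_of_lt (lt_of_le_of_ne hle (Ne.symm hne))
      exact (Nat.le_of_dvd h3 h2).trans ((Nat.sub_le P Q).trans hPle)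
    · have h1 : ((P : ℕ) : ℤ) - (Q : ℤ) = -((Q - P : ℕ) : ℤ) := by
        rw [Nat.cast_sub hlt.le]; ring
      rw [h1, dvd_neg] at hdvd
      have h2 : d ∣ Q - P := Int.natCast_dvd_natCast.mp hdvd
      have h3 : 0 < Q - P := Nat.sub_pos_of_lt hlt
      exact (Nat.le_of_dvd h3 h2).trans ((Nat.sub_le Q P).trans hQle)
  have hm1 : (0 : ℝ) < ((max a₁ c₁ : ℕ) : ℝ) := by exact_mod_cast lt_max_of_lt_left ha₁
  have hm2 : (0 : ℝ) < ((max a₂ c₂ : ℕ) : ℝ) := by exact_mod_cast lt_max_of_lt_left ha₂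
  have hcast : (d : ℝ) ≤ ((max a₁ c₁ : ℕ) : ℝ) * ((max a₂ c₂ : ℕ) : ℝ) ^ n := by exact_mod_cast hdle
  have h := Real.log_le_log (by exact_mod_cast hd) hcast
  rw [Real.log_mul hm1.ne' (pow_pos hm2 n).ne', Real.log_pow] at h
  linarith

end Summit.ABC.ABC.Theorems
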